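import Mathlib
import Literature.MathematicalPhysics.QuantumFieldTheory.Balaban1983to89.B2LargeField
import Literature.MathematicalPhysics.QuantumFieldTheory.Balaban1983to89.HiggsAveraging

/-!
# `Balaban1983to89.B2Restr216Lattice` — T. Bałaban, *(Higgs)₂,₃ quantum fields in a finite volume. II. An upper
# bound*, Commun. Math. Phys. **86** (1982) 555–594 [Balaban1982Higgs2]: the telescoping estimates of p. 559 behind
# (2.16)–(2.17) on the CONCRETE lattice — blocks (I.1.17) and staircase contours (I.2.1) of the carriers
# `…HiggsLattice` / `…HiggsAveraging` (support file 1/2 of Phase-2 row B2.Eq2.17; file 2/2 = `…B2Restr216Concrete`)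

statement-level skeleton of published theorems with citation tags; proofs where landed; nothing here is a claim about the Yang–Mills mass gap

PDF held: `paper:balaban1982-cmp86-higgs23-ii` (journal page = PDF page + 554) and, for the lattice definitions of
part I = [Balaban1982Higgs1], `paper:balaban1982-cmp85-higgs23-i` (journal page = PDF page + 602); displays read
from the ×2 renders `…/pages/1982-cmp86-higgs23-II/…-p005-x2.png` (p. 559) and `…/pages/1982-cmp85-higgs23-I/…-p006-x2.png`
(p. 608) of the cell `pub-balaban`.

WHAT IS REPRODUCED (no statement row of its own; kernel lemmas consumed by `…B2Restr216Concrete`, which proves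
SKELETON row B2.Eq2.17 = `B2Sect2Statements.Restr216Printed` at the concrete model).  §1: the combinatorics of the
corner-anchored blocks B(y) of (I.1.17) on the typer's tori `HiggsLattice.Site P k` in the standing range k < K
(labels of `blockOf`/`emb`, membership `mem_block_iff`, y ∈ B(y), |B(y)| = L^d via the offset parametrisation
`blockOffsetEquiv` — the count behind the weight L^{−d} of (I.2.7)).  §2, the first step T₁ = `Site P 0`: the unit-lattice
covariant derivative (D_Aφ)(b) = U(A_b)φ(b₊) − φ(b₋) of the rescaled action (2.1) p. 556 (`covDiff`, = η·D^η_A of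
(I.1.7)), the corners of the staircase Γ_{y,x} (I.2.1) (`cornerN`), the splitting of `HiggsAveraging.contourSum` into
its first segment and the rest (`contourSum_split`), and p. 559's estimate *"|U(A(Γ_{y,x}))φ(x) − φ(y)| =
|Σ_{b⊂Γ_{y,x}}U(A(Γ_{y,b₋}))(D_Aφ)(b)| ≤ Σ_{b⊂Γ_{y,x}}|(D_Aφ)(b)|"* for the CONCRETE transports U = exp(qηeA) of I p. 605
(`ChargeData.U`, unitary): along a straight segment it is r14's abstract `B2LargeField.norm_transport_sub_le_mul`
instantiated (`norm_U_segSum_sub_le`; isometries by `norm_U_apply`, cocycle by `ChargeData.U_add`), along the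
staircase an induction over its corners (`norm_U_contourSum_cornerN_sub_le`).  Nothing of the paper is asserted
beyond these kernel-checked lemmas; every `def` has a body.
Unit `lit-balaban-p17` (Phase-2 proof seat p17), HOME `run/shared/lean/pub/lit-balaban/` (PHASE2-TARGETS.md §G.3
line p17; referee ref-4).  Value = support of one SKELETON row proved at the concrete model; NOT summit progress.
-/

open scoped BigOperators
open Finset

namespace Literature.MathematicalPhysics.QuantumFieldTheory.Balaban1983to89.B2Restr216Lattice

open Literature.MathematicalPhysics.QuantumFieldTheory.Balaban1983to89.HiggsLattice
open Literature.MathematicalPhysics.QuantumFieldTheory.Balaban1983to89.HiggsAveraging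

variable {P : Params}

/-! ## 1. Blocks of the corner-anchored tori (I.1.17): labels, membership, |B(y)| = L^d -/

section Blocks

variable {k : ℕ}

/-- (I.1.2)/(I.1.19): `2L^{K−k}ML′_μ = L · 2L^{K−k−1}ML′_μ` — the fine torus has `L` times as many sites per direction as
the next coarser one, in the standing range `k < K`. [cite: Balaban1982Higgs1, (1.19) p.607] -/
theorem sitesPerDir_eq_mul (hk : k < P.K) (μ : Fin P.d) :
    P.sitesPerDir k μ = P.L * P.sitesPerDir (k + 1) μ := by
  unfold Params.sitesPerDir
  obtain ⟨m, hm⟩ : ∃ m, P.K - k = m + 1 := ⟨P.K - k - 1, by omega⟩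
  have h2 : P.K - (k + 1) = m := by omega
  rw [hm, h2, pow_succ]
  ring

/-- The label of the block `B(y) ∋ x` is the integer quotient `n / L` of the label of `x` ((I.1.17): corner-anchored
blocks; no reduction modulo the site count occurs for `k < K`). [cite: Balaban1982Higgs1, (1.17) p.606] -/
theorem val_blockOf (hk : k < P.K) (x : Site P k) (μ : Fin P.d) :
    ((HiggsLattice.blockOf x) μ).val = (x μ).val / P.L := by
  simp only [blockOf]
  rw [ZMod.val_natCast, Nat.mod_eq_of_lt]
  rw [Nat.div_lt_iff_lt_mul P.hL]
  have h := ZMod.val_lt (x μ)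
  have h2 := sitesPerDir_eq_mul hk μ
  linarith [mul_comm P.L (P.sitesPerDir (k + 1) μ)]

/-- `x ∈ B(y)` iff every coordinate label of `x` has quotient by `L` equal to the label of `y` ((I.1.17)
`y_μ ≤ x_μ < y_μ + L^{k+1}ε`). [cite: Balaban1982Higgs1, (1.17) p.606] -/
theorem mem_block_iff (hk : k < P.K) (y : Site P (k + 1)) (x : Site P k) :
    x ∈ block y ↔ ∀ μ, (x μ).val / P.L = (y μ).val := by
  simp only [block, Finset.mem_filter, Finset.mem_univ, true_and]
  constructor
  · intro h μ
    rw [← val_blockOf hk x μ, h]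
  · intro h
    funext μ
    apply ZMod.val_injective
    rw [val_blockOf hk]
    exact h μ

/-- The label of the coarse site `y ∈ T^{(k+1)} ⊂ T^{(k)}` ((I.1.19), `HiggsLattice.emb`) is `nL` (corner of the block).
[cite: Balaban1982Higgs1, (1.19) p.607] -/
theorem val_emb (hk : k < P.K) (y : Site P (k + 1)) (μ : Fin P.d) :
    ((HiggsLattice.emb y) μ).val = (y μ).val * P.L := by
  simp only [emb]
  rw [ZMod.val_natCast, Nat.mod_eq_of_lt]
  have hy := Nat.mul_lt_mul_of_pos_right (ZMod.val_lt (y μ)) P.hL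
  rw [sitesPerDir_eq_mul hk]
  linarith [mul_comm P.L (P.sitesPerDir (k + 1) μ)]

/-- `y ∈ B(y)`: the corner `y` of the block `B(y)` belongs to it ((I.1.17) with `x = y`). [cite: Balaban1982Higgs1, (1.17) p.606] -/
theorem emb_mem_block (hk : k < P.K) (y : Site P (k + 1)) : HiggsLattice.emb y ∈ HiggsLattice.block y := by
  rw [mem_block_iff hk]
  intro μ
  rw [val_emb hk, Nat.mul_div_cancel _ P.hL]

/-- `x ∈ B(Λ)` as soon as `x ∈ B(y)` for some `y ∈ Λ` ((I.1.18) `B(Λ) = ⋃_{y∈Λ} B(y)`). [cite: Balaban1982Higgs1, (1.18) p.607] -/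
theorem mem_blockSet_of_mem_block {Λ : Finset (Site P (k + 1))} {y : Site P (k + 1)} (hy : y ∈ Λ) {x : Site P k}
    (hx : x ∈ block y) : x ∈ blockSet Λ := by
  rw [mem_blockSet]
  simp only [block, Finset.mem_filter, Finset.mem_univ, true_and] at hx
  rwa [hx]

/-- Changing one coordinate of a site of `B(y)` to another label with the same quotient keeps it in `B(y)` (blocks are
coordinate boxes, (I.1.17)). [cite: Balaban1982Higgs1, (1.17) p.606] -/
theorem update_mem_block (hk : k < P.K) {y : Site P (k + 1)} {z : Site P k} (hz : z ∈ block y) (μ : Fin P.d)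
    (v : ZMod (P.sitesPerDir k μ)) (hv : v.val / P.L = (y μ).val) : (Function.update z μ v : Site P k) ∈ block y := by
  rw [mem_block_iff hk] at hz
  refine (mem_block_iff hk y _).2 fun ν => ?_
  by_cases h : ν = μ
  · subst h
    rw [Function.update_self]
    exact hv
  · rw [Function.update_of_ne h]
    exact hz ν

/-- The fine site of `B(y)` with offset `r ∈ {0,…,L−1}^d` from the corner `nL` ((I.1.17)). [cite: Balaban1982Higgs1, (1.17) p.606] -/
def blockPt (y : Site P (k + 1)) (r : Fin P.d → Fin P.L) : Site P k :=
  fun μ => (((y μ).val * P.L + r μ : ℕ) : ZMod (P.sitesPerDir k μ))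

/-- Label of `blockPt y r` is `nL + r` (no wrap-around for `k < K`). [cite: Balaban1982Higgs1, (1.17) p.606] -/
theorem val_blockPt (hk : k < P.K) (y : Site P (k + 1)) (r : Fin P.d → Fin P.L) (μ : Fin P.d) :
    ((blockPt y r) μ).val = (y μ).val * P.L + r μ := by
  simp only [blockPt]
  rw [ZMod.val_natCast, Nat.mod_eq_of_lt]
  have hy : (y μ).val + 1 ≤ P.sitesPerDir (k + 1) μ := ZMod.val_lt (y μ)
  have h1 := Nat.mul_le_mul_right P.L hy
  have h2 := (r μ).isLt
  rw [sitesPerDir_eq_mul hk]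
  rw [Nat.add_mul, one_mul] at h1
  linarith [mul_comm P.L (P.sitesPerDir (k + 1) μ)]

/-- `blockPt y r ∈ B(y)`. [cite: Balaban1982Higgs1, (1.17) p.606] -/
theorem blockOf_blockPt (hk : k < P.K) (y : Site P (k + 1)) (r : Fin P.d → Fin P.L) :
    HiggsLattice.blockOf (blockPt y r) = y := by
  funext μ
  apply ZMod.val_injective
  rw [val_blockOf hk, val_blockPt hk, mul_comm, Nat.mul_add_div P.hL, Nat.div_eq_of_lt (r μ).isLt, add_zero]

/-- `B(y)` is parametrised bijectively by the offsets `{0,…,L−1}^d` ((I.1.17): `y_μ ≤ x_μ < y_μ + L`, unit lattice).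
[cite: Balaban1982Higgs1, (1.17) p.606] -/
def blockOffsetEquiv (hk : k < P.K) (y : Site P (k + 1)) :
    {x : Site P k // blockOf x = y} ≃ (Fin P.d → Fin P.L) where
  toFun x := fun μ => ⟨(x.1 μ).val % P.L, Nat.mod_lt _ P.hL⟩
  invFun r := ⟨blockPt y r, blockOf_blockPt hk y r⟩
  left_inv x := by
    obtain ⟨x, hx⟩ := x
    apply Subtype.ext
    funext μ
    apply ZMod.val_injective
    show ((blockPt y fun μ => ⟨(x μ).val % P.L, Nat.mod_lt _ P.hL⟩) μ).val = (x μ).val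
    rw [val_blockPt hk]
    have h1 : (x μ).val / P.L = (y μ).val := by rw [← val_blockOf hk x μ, hx]
    have h2 := Nat.div_add_mod' ((x μ).val) P.L
    rw [h1] at h2
    exact h2
  right_inv r := by
    funext μ
    apply Fin.ext
    show ((blockPt y r) μ).val % P.L = (r μ : ℕ)
    rw [val_blockPt hk, Nat.mul_add_mod', Nat.mod_eq_of_lt (r μ).isLt]

/-- `|B(y)| = L^d` — the count behind the weight `L^{−d}` of (I.2.7) (`L^{−d}·|B(y)| = 1`), standing range `k < K`.
[cite: Balaban1982Higgs1, (1.17) p.606] -/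
theorem card_block (hk : k < P.K) (y : Site P (k + 1)) : (HiggsLattice.block y).card = P.L ^ P.d := by
  have h : Fintype.card {x : Site P k // blockOf x = y} = P.L ^ P.d := by
    rw [Fintype.card_congr (blockOffsetEquiv hk y), Fintype.card_fun, Fintype.card_fin, Fintype.card_fin]
  rw [Fintype.card_subtype] at h
  rw [← h, block]

end Blocks

/-! ## 2. The first step: T₁ = T^{(0)}, T′₁ = T^{(1)} — contours, segments, transports -/

section Contours

variable {N : ℕ}

/-- On `T^{(0)}` the inclusion into the finest lattice is the identity (`L^0 = 1`). [cite: Balaban1982Higgs1, (1.20) p.607] -/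
theorem toFinest_zero (x : Site P 0) : toFinest x = x := by
  funext μ
  simp [toFinest]

/-- On `T^{(1)}` the inclusion into the finest lattice is `HiggsLattice.emb` (`L^1 = L`). [cite: Balaban1982Higgs1, (1.19) p.607] -/
theorem toFinest_one (y : Site P 1) : toFinest y = emb y := by
  funext μ
  simp [toFinest, emb]

/-- Zero steps along a segment: `u + 0·e_μ = u`. [cite: Balaban1982Higgs1, (2.1) p.608] -/
theorem shiftN_zero (u : Site P 0) (μ : Fin P.d) : shiftN u μ 0 = u := by
  simp [shiftN]

/-- One more step along a segment: `(u + ie_μ) + e_μ = u + (i+1)e_μ` — the bond `⟨u + ie_μ, u + (i+1)e_μ⟩` of the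
segment (I.2.1). [cite: Balaban1982Higgs1, (2.1) p.608] -/
theorem shiftN_succ (u : Site P 0) (μ : Fin P.d) (i : ℕ) : (shiftN u μ i).shift μ = shiftN u μ (i + 1) := by
  unfold shiftN Site.shift
  rw [Function.update_self, Function.update_idem, Nat.cast_succ, add_assoc]

/-- The sum (I.2.3) along a segment of `n + 1` bonds = the sum along `n` bonds + the last bond. [cite: Balaban1982Higgs1, (2.3) p.608] -/
theorem segSum_succ (A : VecField P 0) (u : Site P 0) (μ : Fin P.d) (n : ℕ) :
    segSum A u μ (n + 1) = segSum A u μ n + A ⟨shiftN u μ n, μ⟩ :=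
  Finset.sum_range_succ _ _

/-- The unit-lattice covariant derivative of the rescaled action (2.1) p. 556: `(D_Aφ)(b) = U(A_b)φ(b₊) − φ(b₋)` on the
bonds of T₁ = `Site P 0` (the restriction `|(D_Aφ)(b)| ≤ p(ε)` of (2.2) is on this quantity). [cite: Balaban1982Higgs2, (2.1) p.556] -/
noncomputable def covDiff (C : ChargeData N) (A : VecField P 0) (φ : ScalarField P 0 N) (b : PBond P 0) :
    EuclideanSpace ℝ (Fin N) :=
  C.U (P.mesh 0) (A b) (φ b.tgt) - φ b.src

/-- Dictionary with part I: `(D_Aφ)(b) = η·(D^η_Aφ)(b)` for the covariant derivative (I.1.7) `HiggsLattice.covDeriv` at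
the mesh `η` of `T^{(0)}` (the rescaling to the unit lattice). [cite: Balaban1982Higgs2, (2.1) p.556] -/
theorem covDiff_eq_smul_covDeriv (C : ChargeData N) (A : VecField P 0) (φ : ScalarField P 0 N) (b : PBond P 0) :
    covDiff C A φ b = P.mesh 0 • covDeriv C A φ b := by
  unfold covDiff covDeriv
  rw [smul_smul, mul_inv_cancel₀ (P.mesh_pos 0).ne', one_smul]

/-- `U(A)` is unitary (I p. 605): `|U(A)v| = |v|`. [cite: Balaban1982Higgs1, (1.7) p.605] -/
theorem norm_U_apply (C : ChargeData N) (η a : ℝ) (v : EuclideanSpace ℝ (Fin N)) : ‖C.U η a v‖ = ‖v‖ :=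
  ContinuousLinearMap.norm_map_of_mem_unitary (C.U_mem_unitary η a) v

/-- **p. 559, the telescoping estimate along a straight segment**: `|U(A(⟨u, u + ne_μ⟩))φ(u + ne_μ) − φ(u)| ≤
Σ_{b}|(D_Aφ)(b)| ≤ n·p` when every bond of the segment has `|(D_Aφ)(b)| ≤ p` — r14's abstract
`B2LargeField.norm_transport_sub_le_mul` at the concrete transports `U(A(⟨u, u + ie_μ⟩))` (isometries by `norm_U_apply`,
cocycle by `ChargeData.U_add`). [cite: Balaban1982Higgs2, (2.16) p.559] -/
theorem norm_U_segSum_sub_le (C : ChargeData N) (A : VecField P 0) (φ : ScalarField P 0 N) (u : Site P 0)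
    (μ : Fin P.d) (n : ℕ) {p : ℝ} (hD : ∀ i, i < n → ‖covDiff C A φ ⟨shiftN u μ i, μ⟩‖ ≤ p) :
    ‖C.U (P.mesh 0) (segSum A u μ n) (φ (shiftN u μ n)) - φ u‖ ≤ n * p := by
  have h := B2LargeField.norm_transport_sub_le_mul n (fun i => φ (shiftN u μ i))
    (fun i v => C.U (P.mesh 0) (segSum A u μ i) v) (fun i => covDiff C A φ ⟨shiftN u μ i, μ⟩)
    (fun v => by simp [segSum, ChargeData.U_zero])
    (fun i v w => by rw [← map_sub, norm_U_apply])
    (fun i => by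
      rw [segSum_succ, ChargeData.U_add, mul_apply_eq_comp, covDiff, PBond.tgt, shiftN_succ, add_sub_cancel])
    hD
  simpa [shiftN_zero] using h

/-- The corners of the staircase (I.2.1) indexed by an integer threshold: coordinates `< t` from `y`, `≥ t` from `x`
(`cornerN y x d = y`, `cornerN y x 0 = x`; `HiggsAveraging.corner y x i = cornerN y x (i+1)`). [cite: Balaban1982Higgs1, (2.1) p.608] -/
def cornerN (y x : Site P 0) (t : ℕ) : Site P 0 := fun j => if (j : ℕ) < t then y j else x j

/-- `cornerN y x 0 = x`. [cite: Balaban1982Higgs1, (2.1) p.608] -/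
theorem cornerN_zero (y x : Site P 0) : cornerN y x 0 = x := by
  funext j; simp [cornerN]

/-- `cornerN y x d = y`. [cite: Balaban1982Higgs1, (2.1) p.608] -/
theorem cornerN_d (y x : Site P 0) : cornerN y x P.d = y := by
  funext j; simp [cornerN, j.isLt]

/-- Consecutive corners differ in one coordinate: corner `t` is corner `t+1` with coordinate `t` set to `x_t`.
[cite: Balaban1982Higgs1, (2.1) p.608] -/
theorem update_cornerN_succ (y x : Site P 0) (t : Fin P.d) :
    Function.update (cornerN y x (t + 1)) t (x t) = cornerN y x t := by
  funext j
  by_cases hj : j = t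
  · subst hj
    rw [Function.update_self]
    simp [cornerN]
  · rw [Function.update_of_ne hj]
    have : (j : ℕ) ≠ t := fun h => hj (Fin.ext h)
    simp only [cornerN]
    split_ifs <;> first | rfl | omega

/-- The trivial contour: `A(Γ_{x,x}) = 0`. [cite: Balaban1982Higgs1, (2.3) p.608] -/
theorem contourSum_self (A : VecField P 0) (x : Site P 0) : contourSum A x x = 0 := by
  simp [contourSum, segSum]

/-- Splitting off the FIRST segment of the staircase (I.2.1) (it moves the highest coordinate in which the endpoints
differ): if `y` and `x` agree in the coordinates `> t`, then `A(Γ_{y,x}) = A(⟨y, y + n_te_t⟩) + A(Γ_{y′,x})` with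
`y′ = y` except `y′_t = x_t`, `n_t` = the number of steps in direction `t`. [cite: Balaban1982Higgs1, (2.1) p.608] -/
theorem contourSum_split (A : VecField P 0) (y x : Site P 0) (t : Fin P.d) (hagree : ∀ j : Fin P.d, t < j → y j = x j) :
    contourSum A y x = segSum A y t (x t - y t).val + contourSum A (Function.update y t (x t)) x := by
  unfold contourSum
  rw [← Finset.add_sum_erase _ _ (Finset.mem_univ t),
    ← Finset.add_sum_erase _ (fun i => segSum A (corner (Function.update y t (x t)) x i) i
      (x i - Function.update y t (x t) i).val) (Finset.mem_univ t)]
  have hcorner : corner y x t = y := by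
    funext j
    by_cases hj : j ≤ t
    · simp [corner, hj]
    · simp only [corner, hj, if_false]
      exact (hagree j (lt_of_not_ge hj)).symm
  have hzero : (x t - Function.update y t (x t) t).val = 0 := by simp
  rw [hcorner, hzero]
  have hseg0 : segSum A (corner (Function.update y t (x t)) x t) t 0 = 0 := by simp [segSum]
  rw [hseg0, zero_add, add_right_inj]
  refine Finset.sum_congr rfl fun i hi => ?_
  have hit : i ≠ t := (Finset.mem_erase.mp hi).1
  rcases lt_or_gt_of_ne hit with hlt | hgt
  · -- `i < t`: the corners and the lengths agree
    have hc : corner y x i = corner (Function.update y t (x t)) x i := by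
      funext j
      by_cases hji : j ≤ i
      · have hjt : j ≠ t := fun h => by subst h; exact absurd hji (not_le.mpr hlt)
        simp [corner, hji, Function.update_of_ne hjt]
      · simp [corner, hji]
    rw [hc, Function.update_of_ne hit]
  · -- `i > t`: both segments are empty
    have h1 : (x i - y i).val = 0 := by rw [hagree i hgt, sub_self, ZMod.val_zero]
    have h2 : (x i - Function.update y t (x t) i).val = 0 := by
      rw [Function.update_of_ne hit, hagree i hgt, sub_self, ZMod.val_zero]
    rw [h1, h2]
    simp [segSum]

/-- **p. 559, the telescoping estimate along the staircase** Γ_{y,x} (I.2.1), by induction over its corners: if the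
numbers of steps are `≤ m` in every direction and every bond of the staircase has `|(D_Aφ)(b)| ≤ p`, then from the
corner `t` on, `|U(A(Γ))φ(x) − φ(corner_t)| ≤ t·m·p`. [cite: Balaban1982Higgs2, (2.16) p.559] -/
theorem norm_U_contourSum_cornerN_sub_le (C : ChargeData N) (A : VecField P 0) (φ : ScalarField P 0 N)
    (y x : Site P 0) {m : ℕ} {p : ℝ} (hp : 0 ≤ p) (hn : ∀ t : Fin P.d, (x t - y t).val ≤ m)
    (hD : ∀ (t : Fin P.d) (j : ℕ), j < (x t - y t).val →
      ‖covDiff C A φ ⟨shiftN (cornerN y x (t + 1)) t j, t⟩‖ ≤ p) :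
    ∀ t : ℕ, t ≤ P.d →
      ‖C.U (P.mesh 0) (contourSum A (cornerN y x t) x) (φ x) - φ (cornerN y x t)‖ ≤ t * (m * p) := by
  intro t
  induction t with
  | zero =>
    intro _
    simp [cornerN_zero, contourSum_self, ChargeData.U_zero]
  | succ t ih =>
    intro ht
    have ht' : t < P.d := ht
    set τ : Fin P.d := ⟨t, ht'⟩ with hτ
    have hih := ih ht'.le
    -- the corner `t+1` agrees with `x` above `t` and with `y` at `t`
    have hagree : ∀ j : Fin P.d, τ < j → cornerN y x (t + 1) j = x j := by
      intro j hj
      have : ¬ ((j : ℕ) < t + 1) := by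
        have h := Fin.lt_def.mp hj; simp only [hτ] at h; omega
      simp [cornerN, this]
    have hct : cornerN y x (t + 1) τ = y τ := by simp [cornerN, hτ]
    have hsplit := contourSum_split A (cornerN y x (t + 1)) x τ hagree
    have hupd : Function.update (cornerN y x (t + 1)) τ (x τ) = cornerN y x t := update_cornerN_succ y x τ
    rw [hupd] at hsplit
    -- the first segment ends at the corner `t`
    have hshift : shiftN (cornerN y x (t + 1)) τ (x τ - cornerN y x (t + 1) τ).val = cornerN y x t := by
      rw [← hupd, shiftN, ZMod.natCast_zmod_val, add_sub_cancel]
    have hseg : ‖C.U (P.mesh 0) (segSum A (cornerN y x (t + 1)) τ (x τ - cornerN y x (t + 1) τ).val)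
        (φ (cornerN y x t)) - φ (cornerN y x (t + 1))‖ ≤ m * p := by
      have h := norm_U_segSum_sub_le C A φ (cornerN y x (t + 1)) τ (x τ - cornerN y x (t + 1) τ).val
        (p := p) (fun i hi => hD τ i (by rwa [hct] at hi))
      rw [hshift] at h
      refine h.trans (mul_le_mul_of_nonneg_right ?_ hp)
      rw [hct]
      exact_mod_cast hn τ
    rw [hsplit, ChargeData.U_add, mul_apply_eq_comp]
    have key : C.U (P.mesh 0) (segSum A (cornerN y x (t + 1)) τ (x τ - cornerN y x (t + 1) τ).val)
          (C.U (P.mesh 0) (contourSum A (cornerN y x t) x) (φ x)) - φ (cornerN y x (t + 1))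
        = C.U (P.mesh 0) (segSum A (cornerN y x (t + 1)) τ (x τ - cornerN y x (t + 1) τ).val)
            (C.U (P.mesh 0) (contourSum A (cornerN y x t) x) (φ x) - φ (cornerN y x t))
          + (C.U (P.mesh 0) (segSum A (cornerN y x (t + 1)) τ (x τ - cornerN y x (t + 1) τ).val)
              (φ (cornerN y x t)) - φ (cornerN y x (t + 1))) := by
      rw [map_sub]; abel
    rw [key]
    refine (norm_add_le _ _).trans ?_
    rw [norm_U_apply]
    push_cast
    nlinarith [hih, hseg]

end Contours

end Literature.MathematicalPhysics.QuantumFieldTheory.Balaban1983to89.B2Restr216Lattice
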